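import Mathlib
import HarnessLib
import Summits.RiemannHypothesis.RiemannHypothesis.Theses.MayerPairing

/-!
# RiemannHypothesis / MayerPairing — conjugation symmetry of the eigenvalue predicate

Route `RiemannHypothesis/MayerPairing`, item stmt-RiemannHypothesis-1473 (`Target`), helper file.

The route types "μ is an eigenvalue of Mayer's transfer operator `L_s`, `s = σ + iτ`" by the
inlined Lewis–Zagier/Chang–Mayer predicate
`∃ f δ, 0 < δ ∧ f holomorphic on {Re z > -δ} ∧ f ≢ 0 on {Re z > 0} ∧
   μ (f z - f (z+1)) = (z+1)^{-2s} f (1/(z+1)) ∧ μ f x - f 0 (x+1)^{1-2s}/(2s-1) → 0`.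
Here we prove that this predicate is symmetric under complex conjugation,
`(σ, τ, μ) ↦ (σ, -τ, conj μ)`, via `f ↦ conj ∘ f ∘ conj` (after shrinking `δ` to `min δ 1` so that
`z + 1` stays off the branch cut of the principal power). Consequences recorded:

* `mayerPairing_unitCircleCrossedOnce_iff_nonneg` : the monotonicity crux `UnitCircleCrossedOnce`
  (all heights `|τ| ≥ 7`) is equivalent to its restriction to heights `τ ≥ 7`;
* `mayerPairing_target_iff_nonneg` : hence the same reduction for `Target`.

Mathlib only (`Complex.conj_cpow`, `DifferentiableAt.conj_conj`). References: C.-H. Chang and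
D. Mayer, Contemp. Math. 290 (2001), (2.47)–(2.49); the symmetry is the elementary
`L_{s̄} = C L_s C` with `C f = conj ∘ f ∘ conj`.
-/

namespace Summit.RiemannHypothesis.RiemannHypothesis.Theorems

open Filter Topology ComplexConjugate
open Summit.RiemannHypothesis.RiemannHypothesis.Theses.MayerPairing

/-- **Conjugation symmetry of the inlined Mayer-eigenvalue predicate.** If `μ` is an eigenvalue of
`L_{σ+iτ}` in the route's functional-equation sense (witness `f`), then `conj μ` is an eigenvalue of
`L_{σ-iτ}` (witness `z ↦ conj (f (conj z))`, on the half-plane `Re z > -min δ 1`). [folklore] -/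
theorem mayerPairing_eigenvalue_conj (σ τ : ℝ) (μ : ℂ)
    (h : ∃ f : ℂ → ℂ, ∃ δ : ℝ, 0 < δ ∧ DifferentiableOn ℂ f {z : ℂ | -δ < z.re} ∧
      (∃ z : ℂ, 0 < z.re ∧ f z ≠ 0) ∧
      (∀ z : ℂ, -δ < z.re → μ * (f z - f (z + 1)) =
        (z + 1) ^ (-(2 * ((σ : ℂ) + (τ : ℂ) * Complex.I))) * f (1 / (z + 1))) ∧
      Tendsto (fun x : ℝ => μ * f x - f 0 * ((x : ℂ) + 1) ^ (1 - 2 * ((σ : ℂ) + (τ : ℂ) * Complex.I)) /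
        (2 * ((σ : ℂ) + (τ : ℂ) * Complex.I) - 1)) atTop (𝓝 0)) :
    ∃ f : ℂ → ℂ, ∃ δ : ℝ, 0 < δ ∧ DifferentiableOn ℂ f {z : ℂ | -δ < z.re} ∧
      (∃ z : ℂ, 0 < z.re ∧ f z ≠ 0) ∧
      (∀ z : ℂ, -δ < z.re → (conj μ) * (f z - f (z + 1)) =
        (z + 1) ^ (-(2 * ((σ : ℂ) + ((-τ : ℝ) : ℂ) * Complex.I))) * f (1 / (z + 1))) ∧
      Tendsto (fun x : ℝ => (conj μ) * f x -
        f 0 * ((x : ℂ) + 1) ^ (1 - 2 * ((σ : ℂ) + ((-τ : ℝ) : ℂ) * Complex.I)) /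
        (2 * ((σ : ℂ) + ((-τ : ℝ) : ℂ) * Complex.I) - 1)) atTop (𝓝 0) := by
  obtain ⟨f, δ, hδ, hdiff, ⟨z₀, hz₀, hfz₀⟩, hfe, hlim⟩ := h
  set s : ℂ := (σ : ℂ) + (τ : ℂ) * Complex.I with hs
  set s' : ℂ := (σ : ℂ) + ((-τ : ℝ) : ℂ) * Complex.I with hs'
  have hss' : conj s = s' := by
    apply Complex.ext <;> simp [hs, hs']
  have h2 : conj (2 : ℂ) = 2 := map_ofNat _ 2
  -- the conjugated witness
  set g : ℂ → ℂ := fun z => conj (f (conj z)) with hg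
  refine ⟨g, min δ 1, lt_min hδ one_pos, ?_, ⟨conj z₀, by simpa using hz₀, ?_⟩, ?_, ?_⟩
  · -- holomorphy of `conj ∘ f ∘ conj`
    intro z hz
    have hz' : -δ < (conj z).re := by
      simp only [Set.mem_setOf_eq] at hz
      rw [Complex.conj_re]
      exact lt_of_le_of_lt (neg_le_neg (min_le_left δ 1)) hz
    have hopen : IsOpen {z : ℂ | -δ < z.re} := isOpen_lt continuous_const Complex.continuous_re
    have hd : DifferentiableAt ℂ f (conj z) := hdiff.differentiableAt (hopen.mem_nhds hz')
    have := hd.conj_conj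
    rw [Complex.conj_conj] at this
    exact this.differentiableWithinAt
  · -- non-vanishing
    simp only [hg, Complex.conj_conj]
    exact (map_ne_zero (starRingEnd ℂ)).mpr hfz₀
  · -- the three-term functional equation
    intro z hz
    have hz1 : -1 < z.re := lt_of_le_of_lt (neg_le_neg (min_le_right δ 1)) hz
    have hzδ : -δ < (conj z).re := by
      rw [Complex.conj_re]
      exact lt_of_le_of_lt (neg_le_neg (min_le_left δ 1)) hz
    have key := congrArg conj (hfe (conj z) hzδ)
    have harg : (conj z + 1).arg ≠ Real.pi := by
      rw [Ne, Complex.arg_eq_pi_iff, not_and_or]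
      left
      rw [not_lt, Complex.add_re, Complex.conj_re, Complex.one_re]
      linarith
    have hpow : conj ((conj z + 1) ^ (-(2 * s))) = (z + 1) ^ (-(2 * s')) := by
      have := Complex.conj_cpow (conj z + 1) (conj (-(2 * s))) harg
      rw [Complex.conj_conj] at this
      rw [← this]
      congr 1
      · simp
      · rw [map_neg, map_mul, hss', h2]
    simp only [map_mul, map_sub] at key
    rw [hpow] at key
    have h1 : conj (f (conj z + 1)) = g (z + 1) := by
      simp [hg]
    have h2 : conj (f (1 / (conj z + 1))) = g (1 / (z + 1)) := by
      simp [hg]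
    rw [h1, h2] at key
    simpa [hg] using key
  · -- the asymptotic normalisation along the real axis
    have hconj : Tendsto (fun x : ℝ => conj (μ * f x - f 0 * ((x : ℂ) + 1) ^ (1 - 2 * s) /
        (2 * s - 1))) atTop (𝓝 0) := by
      have := (Complex.continuous_conj.tendsto 0).comp hlim
      simpa only [Function.comp_def, map_zero] using this
    refine hconj.congr' ?_
    filter_upwards [eventually_gt_atTop (-1 : ℝ)] with x hx
    have harg : ((x : ℂ) + 1).arg ≠ Real.pi := by
      rw [Ne, Complex.arg_eq_pi_iff, not_and_or]
      left
      rw [not_lt, Complex.add_re, Complex.ofReal_re, Complex.one_re]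
      linarith
    have hpow : conj (((x : ℂ) + 1) ^ (1 - 2 * s)) = ((x : ℂ) + 1) ^ (1 - 2 * s') := by
      have := Complex.conj_cpow ((x : ℂ) + 1) (conj (1 - 2 * s)) harg
      rw [Complex.conj_conj] at this
      have hx1 : conj ((x : ℂ) + 1) = (x : ℂ) + 1 := by simp
      rw [hx1] at this
      rw [← this]
      congr 1
      rw [map_sub, map_one, map_mul, hss', h2]
    have hden : conj (2 * s - 1) = 2 * s' - 1 := by
      rw [map_sub, map_mul, map_one, hss', h2]
    rw [map_sub, map_mul, map_div₀, map_mul, hpow, hden]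
    simp [hg]

/-- **The monotonicity crux reduces to positive heights.** `UnitCircleCrossedOnce` (all heights
`|τ| ≥ 7`) is equivalent to its restriction to `τ ≥ 7`: an eigenvalue selection at height `-τ`
conjugates to one at height `τ` with the same moduli (`mayerPairing_eigenvalue_conj`). [folklore] -/
theorem mayerPairing_unitCircleCrossedOnce_iff_nonneg :
    UnitCircleCrossedOnce ↔
    (∀ τ : ℝ, 7 ≤ τ → ∀ a b : ℝ, 0 < a → a < b → b < 1 / 2 → ∀ Λ : ℝ → ℂ,
      ContinuousOn Λ (Set.Icc a b) →
      (∀ σ ∈ Set.Icc a b, ∃ f : ℂ → ℂ, ∃ δ : ℝ, 0 < δ ∧ DifferentiableOn ℂ f {z : ℂ | -δ < z.re} ∧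
        (∃ z : ℂ, 0 < z.re ∧ f z ≠ 0) ∧
        (∀ z : ℂ, -δ < z.re → Λ σ * (f z - f (z + 1)) =
          (z + 1) ^ (-(2 * ((σ : ℂ) + (τ : ℂ) * Complex.I))) * f (1 / (z + 1))) ∧
        Tendsto (fun x : ℝ => Λ σ * f x -
          f 0 * ((x : ℂ) + 1) ^ (1 - 2 * ((σ : ℂ) + (τ : ℂ) * Complex.I)) /
          (2 * ((σ : ℂ) + (τ : ℂ) * Complex.I) - 1)) atTop (𝓝 0)) →
      ¬ (‖Λ a‖ = 1 ∧ ‖Λ b‖ = 1)) := by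
  constructor
  · intro h τ hτ
    exact h τ (by rw [abs_of_nonneg (by linarith)]; exact hτ)
  · intro h τ hτ a b ha hab hb Λ hΛ heig hnorm
    rcases le_or_gt 0 τ with hpos | hneg
    · rw [abs_of_nonneg hpos] at hτ
      exact h τ hτ a b ha hab hb Λ hΛ heig hnorm
    · rw [abs_of_neg hneg] at hτ
      refine h (-τ) hτ a b ha hab hb (fun σ => conj (Λ σ))
        (Complex.continuous_conj.comp_continuousOn hΛ)
        (fun σ hσ => mayerPairing_eigenvalue_conj σ τ (Λ σ) (heig σ hσ)) ?_
      simpa only [Complex.norm_conj] using hnorm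

/-- **The target reduces to positive heights**: `Target ↔ UnitCircleCrossedOnce⁺ ∧ BranchPairing`,
where `UnitCircleCrossedOnce⁺` is the monotonicity crux restricted to heights `τ ≥ 7`
(by `mayerPairing_unitCircleCrossedOnce_iff_nonneg`; the pairing conjunct already lives at the
positive heights `Im ρ / 2 > 7`). [folklore] -/
theorem mayerPairing_target_iff_nonneg :
    Target ↔
    ((∀ τ : ℝ, 7 ≤ τ → ∀ a b : ℝ, 0 < a → a < b → b < 1 / 2 → ∀ Λ : ℝ → ℂ,
      ContinuousOn Λ (Set.Icc a b) →
      (∀ σ ∈ Set.Icc a b, ∃ f : ℂ → ℂ, ∃ δ : ℝ, 0 < δ ∧ DifferentiableOn ℂ f {z : ℂ | -δ < z.re} ∧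
        (∃ z : ℂ, 0 < z.re ∧ f z ≠ 0) ∧
        (∀ z : ℂ, -δ < z.re → Λ σ * (f z - f (z + 1)) =
          (z + 1) ^ (-(2 * ((σ : ℂ) + (τ : ℂ) * Complex.I))) * f (1 / (z + 1))) ∧
        Tendsto (fun x : ℝ => Λ σ * f x -
          f 0 * ((x : ℂ) + 1) ^ (1 - 2 * ((σ : ℂ) + (τ : ℂ) * Complex.I)) /
          (2 * ((σ : ℂ) + (τ : ℂ) * Complex.I) - 1)) atTop (𝓝 0)) →
      ¬ (‖Λ a‖ = 1 ∧ ‖Λ b‖ = 1)) ∧ BranchPairing) := by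
  change (UnitCircleCrossedOnce ∧ BranchPairing) ↔ _
  rw [mayerPairing_unitCircleCrossedOnce_iff_nonneg]

end Summit.RiemannHypothesis.RiemannHypothesis.Theorems
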